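import Mathlib
import Literature.Geometry.Lorentzian.ReggeWheelerStraightening
import Literature.Analysis.ODE.RiccatiCrumStraightened

/-!
# The peeled residual from last-rung bounds (packaging for stub R)

Last rung of a recessive Crum chain over the Regge–Wheeler family, read in the straightening variable
`y = strRadius M (r x)` (so `dy/dx = 1 − ε`, `ε = strDefect M (r x)`): `W′ = U_prev − W²`, `Q = 2W² − U_prev`
on `(a′, ∞)`, `η := −y W − 1`.  If `η` is within `κ ε` of the SHIFT FAMILY `a/(y − a)` together with its
first two derivatives (scaled by `y`, `y²`), `0 ≤ a ≤ y/4`, `κ ≤ 1/10` and `r ≥ 24M` on `(a′, ∞)`, then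

* `sq_mul_residual_eq` : `y² Q = η + η² + yη′ + ε(1 + η)`; `shift_identity` : on the shift family this
  expression is `ε y²/(y − a)²`;
* `sq_mul_residual_bounds` : `(1 − 3κ) ε ≤ y² Q ≤ 3 ε` — in particular `Q > 0` (`residual_pos`).

Monotonicity, the Hardy size and the packaging into the three registered conclusions of stub R are in
`ReggeWheelerPeeledResidualDeriv`.  This is the algebra `R_D ⇒ R` of the route notes
(PhotonSphereChannels, crux K1R, stub `stub_residualSubHardy`): once an analytic argument delivers the
three `κ ε` bounds, the registered conclusions follow. [folklore]
-/

noncomputable section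

open Set Filter Topology

namespace Literature.Geometry.Lorentzian

namespace ReggeWheeler

/-- `dε/dx` along the tortoise line, as an explicit function (cf. `hasDerivAt_strDefect_comp`). [folklore] -/
def lineDefectDeriv (M : ℝ) (r : ℝ → ℝ) (x : ℝ) : ℝ :=
  -(M / r x ^ 2 * (2 - 3 * M / r x) / Real.sqrt (1 - 2 * M / r x))

/-- First `x`-derivative of the shift profile `a/(y − a)`: `−a(1 − ε)/(y − a)²`. [folklore] -/
def shiftDeriv (M : ℝ) (r : ℝ → ℝ) (a x : ℝ) : ℝ :=
  -(a * (1 - strDefect M (r x))) / (strRadius M (r x) - a) ^ 2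

/-- Second `x`-derivative of the shift profile: `a ε′/(y − a)² + 2a(1 − ε)²/(y − a)³`. [folklore] -/
def shiftDeriv₂ (M : ℝ) (r : ℝ → ℝ) (a x : ℝ) : ℝ :=
  a * lineDefectDeriv M r x / (strRadius M (r x) - a) ^ 2
    + 2 * a * (1 - strDefect M (r x)) ^ 2 / (strRadius M (r x) - a) ^ 3

/-- **Last-rung data with quantitative closeness to the shift family.**  Fields: the tortoise radius; the
last Riccati/Crum relations on `(a′, ∞)`; derivatives `η′, η″` of `η = −yW − 1`; the far-side and shift
conditions `r ≥ 24M`, `0 ≤ a ≤ y/4`; and the three bounds `|η − a/(y−a)| ≤ κε`,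
`|y (η′ − (a/(y−a))′)| ≤ κε`, `|y² (η″ − (a/(y−a))″)| ≤ κε` with `κ ≤ 1/10`. [folklore] -/
structure PeeledLastRung (M : ℝ) (r : ℝ → ℝ) (xc : ℝ) (W Up Q η' η'' : ℝ → ℝ) (a' a κ : ℝ) :
    Prop where
  tortoise : IsTortoiseRadius M r xc
  riccati : ∀ x, a' < x → HasDerivAt W (Up x - W x ^ 2) x
  crum : ∀ x, a' < x → Q x = 2 * W x ^ 2 - Up x
  hasDerivAt_eta : ∀ x, a' < x → HasDerivAt (fun t => -strRadius M (r t) * W t - 1) (η' x) x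
  hasDerivAt_eta' : ∀ x, a' < x → HasDerivAt η' (η'' x) x
  far : ∀ x, a' < x → 24 * M ≤ r x
  shift_nonneg : 0 ≤ a
  shift_le : ∀ x, a' < x → 4 * a ≤ strRadius M (r x)
  kappa_nonneg : 0 ≤ κ
  kappa_le : κ ≤ 1 / 10
  bound₀ : ∀ x, a' < x →
    |(-strRadius M (r x) * W x - 1) - a / (strRadius M (r x) - a)| ≤ κ * strDefect M (r x)
  bound₁ : ∀ x, a' < x →
    |strRadius M (r x) * (η' x - shiftDeriv M r a x)| ≤ κ * strDefect M (r x)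
  bound₂ : ∀ x, a' < x →
    |strRadius M (r x) ^ 2 * (η'' x - shiftDeriv₂ M r a x)| ≤ κ * strDefect M (r x)

namespace PeeledLastRung

variable {M : ℝ} {r : ℝ → ℝ} {xc : ℝ} {W Up Q η' η'' : ℝ → ℝ} {a' a κ : ℝ}

/-- Basic sizes at a point `x > a′`: `y > 0`, `0 < ε ≤ 1/8`, `3y/4 ≤ y − a`, `0 ≤ a/(y−a) ≤ 1/3`. [folklore] -/
theorem sizes (h : PeeledLastRung M r xc W Up Q η' η'' a' a κ) {x : ℝ} (hx : a' < x) :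
    0 < strRadius M (r x) ∧ 0 < strDefect M (r x) ∧ strDefect M (r x) ≤ 1 / 8 ∧
      3 / 4 * strRadius M (r x) ≤ strRadius M (r x) - a ∧ 0 < strRadius M (r x) - a ∧
      0 ≤ a / (strRadius M (r x) - a) ∧ a / (strRadius M (r x) - a) ≤ 1 / 3 := by
  have hM := h.tortoise.mass_pos
  have hρ := h.tortoise.two_mul_lt x
  have h24 := h.far x hx
  have h3 : 3 * M ≤ r x := by linarith
  have hy := strRadius_pos hM.le hρ
  have hε := strDefect_pos hM h3
  have hεle := strDefect_le hM h3
  have hρ0 : 0 < r x := h.tortoise.pos x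
  have hε8 : strDefect M (r x) ≤ 1 / 8 := by
    have h1 : 2 * M / r x ≤ 1 / 12 := by
      rw [div_le_iff₀ hρ0]; linarith
    have h2 : 3 * M ^ 2 / r x ^ 2 ≤ 1 / 48 := by
      rw [div_le_iff₀ (pow_pos hρ0 2)]; nlinarith
    linarith
  have ha := h.shift_le x hx
  have ha0 := h.shift_nonneg
  have hya : 3 / 4 * strRadius M (r x) ≤ strRadius M (r x) - a := by linarith
  have hya0 : 0 < strRadius M (r x) - a := by linarith
  refine ⟨hy, hε, hε8, hya, hya0, div_nonneg ha0 hya0.le, ?_⟩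
  rw [div_le_iff₀ hya0]
  linarith

/-- **The residual in `η`-form**: `y² Q = η + η² + y η′ + ε (1 + η)` on `(a′, ∞)`, `η = −yW − 1`. [folklore] -/
theorem sq_mul_residual_eq (h : PeeledLastRung M r xc W Up Q η' η'' a' a κ) {x : ℝ} (hx : a' < x) :
    strRadius M (r x) ^ 2 * Q x =
      (-strRadius M (r x) * W x - 1) + (-strRadius M (r x) * W x - 1) ^ 2
        + strRadius M (r x) * η' x + strDefect M (r x) * (1 + (-strRadius M (r x) * W x - 1)) := by
  have hM := h.tortoise.mass_pos
  have hy : ∀ t, 0 < strRadius M (r t) := fun t => strRadius_pos hM.le (h.tortoise.two_mul_lt t)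
  have hWη : ∀ t, W t = -(1 + (-strRadius M (r t) * W t - 1)) / strRadius M (r t) := by
    intro t
    have := (hy t).ne'
    field_simp
    ring
  have key := Literature.Analysis.ODE.crum_residual_eq_eta (h.riccati x hx) hWη
    (h.hasDerivAt_eta x hx) (hasDerivAt_strRadius_comp h.tortoise x) (hy x).ne'
  have hyx : strRadius M (r x) ≠ 0 := (hy x).ne'
  rw [h.crum x hx, key]
  field_simp

/-- **Main-term identity**: on the shift family the `η`-form equals `ε y²/(y − a)²`. [folklore] -/
theorem shift_identity (h : PeeledLastRung M r xc W Up Q η' η'' a' a κ) {x : ℝ} (hx : a' < x) :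
    a / (strRadius M (r x) - a) + (a / (strRadius M (r x) - a)) ^ 2
        + strRadius M (r x) * shiftDeriv M r a x
        + strDefect M (r x) * (1 + a / (strRadius M (r x) - a))
      = strDefect M (r x) * strRadius M (r x) ^ 2 / (strRadius M (r x) - a) ^ 2 := by
  obtain ⟨hy, hε, hε8, hya, hya0, hηa0, hηa⟩ := h.sizes hx
  have key := (Literature.Analysis.ODE.crum_residual_shift (y := fun t => strRadius M (r t))
    (a := a) (ε := strDefect M (r x)) (hasDerivAt_strRadius_comp h.tortoise x)
    (_root_.sub_pos.mp hya0).ne').2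
  unfold shiftDeriv
  beta_reduce at key
  exact key

/-- Pure-inequality core of `sq_mul_residual_bounds`: the remainder `δ(1 + 2η_a + δ + ε) + yδ₁` is at
most `3κε` in absolute value. [folklore] -/
theorem remainder_abs_le {δ p ηa ε κ : ℝ} (hδ : |δ| ≤ κ * ε) (hp : |p| ≤ κ * ε)
    (hηa0 : 0 ≤ ηa) (hηa : ηa ≤ 1 / 3) (hε0 : 0 ≤ ε) (hε8 : ε ≤ 1 / 8)
    (hκ : κ ≤ 1 / 10) : |δ * (1 + 2 * ηa + δ + ε) + p| ≤ 3 * (κ * ε) := by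
  obtain ⟨hδl, hδu⟩ := abs_le.1 hδ
  obtain ⟨hpl, hpu⟩ := abs_le.1 hp
  have hκε : κ * ε ≤ 1 / 80 := by nlinarith
  have hc0 : 0 ≤ 1 + 2 * ηa + δ + ε := by linarith
  have hc1 : 1 + 2 * ηa + δ + ε ≤ 2 := by linarith
  rw [abs_le]
  constructor
  · have : -(κ * ε) * (1 + 2 * ηa + δ + ε) ≤ δ * (1 + 2 * ηa + δ + ε) :=
      mul_le_mul_of_nonneg_right hδl hc0
    have : -(κ * ε) * 2 ≤ -(κ * ε) * (1 + 2 * ηa + δ + ε) := by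
      apply mul_le_mul_of_nonpos_left hc1; nlinarith
    linarith
  · have : δ * (1 + 2 * ηa + δ + ε) ≤ κ * ε * (1 + 2 * ηa + δ + ε) :=
      mul_le_mul_of_nonneg_right hδu hc0
    have : κ * ε * (1 + 2 * ηa + δ + ε) ≤ κ * ε * 2 := by
      apply mul_le_mul_of_nonneg_left hc1; nlinarith
    linarith

/-- Pure-inequality core: the main term `ε y²/(y−a)²` lies between `ε` and `16ε/9`. [folklore] -/
theorem main_term_bounds {ε y a : ℝ} (hε0 : 0 ≤ ε) (ha0 : 0 ≤ a) (hya : 3 / 4 * y ≤ y - a)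
    (hya0 : 0 < y - a) :
    ε ≤ ε * y ^ 2 / (y - a) ^ 2 ∧ ε * y ^ 2 / (y - a) ^ 2 ≤ 16 / 9 * ε := by
  constructor
  · rw [le_div_iff₀ (pow_pos hya0 2)]
    have : (y - a) ^ 2 ≤ y ^ 2 := by nlinarith
    exact mul_le_mul_of_nonneg_left this hε0
  · rw [div_le_iff₀ (pow_pos hya0 2)]
    have h916 : 9 / 16 * y ^ 2 ≤ (y - a) ^ 2 := by nlinarith
    nlinarith [mul_le_mul_of_nonneg_left h916 hε0]

/-- **Two-sided bound on the peeled residual**: `(1 − 3κ) ε ≤ y² Q ≤ 3 ε` on `(a′, ∞)`. [folklore] -/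
theorem sq_mul_residual_bounds (h : PeeledLastRung M r xc W Up Q η' η'' a' a κ) {x : ℝ}
    (hx : a' < x) :
    (1 - 3 * κ) * strDefect M (r x) ≤ strRadius M (r x) ^ 2 * Q x ∧
      strRadius M (r x) ^ 2 * Q x ≤ 3 * strDefect M (r x) := by
  obtain ⟨hy, hε, hε8, hya, hya0, hηa0, hηa⟩ := h.sizes hx
  have hκ := h.kappa_le
  have heq := h.sq_mul_residual_eq hx
  have hsh := h.shift_identity hx
  -- the remainder identity (pure algebra from the two identities)
  have hrem : strRadius M (r x) ^ 2 * Q x =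
      strDefect M (r x) * strRadius M (r x) ^ 2 / (strRadius M (r x) - a) ^ 2 +
        (((-strRadius M (r x) * W x - 1) - a / (strRadius M (r x) - a)) *
            (1 + 2 * (a / (strRadius M (r x) - a)) +
              ((-strRadius M (r x) * W x - 1) - a / (strRadius M (r x) - a)) + strDefect M (r x)) +
          strRadius M (r x) * (η' x - shiftDeriv M r a x)) := by
    rw [heq, ← hsh]
    ring
  have hR := remainder_abs_le (h.bound₀ x hx) (h.bound₁ x hx) hηa0 hηa hε.le hε8 hκ
  obtain ⟨hRl, hRu⟩ := abs_le.1 hR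
  obtain ⟨hml, hmu⟩ := main_term_bounds hε.le h.shift_nonneg hya hya0
  have hκε : κ * strDefect M (r x) ≤ 1 / 10 * strDefect M (r x) :=
    mul_le_mul_of_nonneg_right hκ hε.le
  rw [hrem]
  constructor <;> linarith

/-- **Positivity of the peeled residual** on `(a′, ∞)`. [folklore] -/
theorem residual_pos (h : PeeledLastRung M r xc W Up Q η' η'' a' a κ) {x : ℝ} (hx : a' < x) :
    0 < Q x := by
  obtain ⟨hy, hε, -, -, -, -, -⟩ := h.sizes hx
  have hκ := h.kappa_le
  have hb := (h.sq_mul_residual_bounds hx).1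
  have hpos : 0 < (1 - 3 * κ) * strDefect M (r x) := mul_pos (by linarith) hε
  have : 0 < strRadius M (r x) ^ 2 * Q x := lt_of_lt_of_le hpos hb
  exact pos_of_mul_pos_right this (sq_nonneg _)


end PeeledLastRung

end ReggeWheeler

end Literature.Geometry.Lorentzian
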